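import Mathlib
import Summits.Langlands.Langlands.Theorems.QuadraticWindowHostInducedRepMemberPaneArchGLOne
import Summits.Langlands.Langlands.Theorems.QuadraticWindowHostInducedRepPaneDefs
import Literature.NumberTheory.Automorphic.BaseChangeArchimedean
import Literature.NumberTheory.Automorphic.AutomorphicTwistWeightOne

/-!
# The pane parameter of the member `P = BC_{L/F}(π ⊗ ω) ⊗ (ψ₀ ∘ N_{L/K})` — sub-stub
# `stub_memberPaneArch` of the member statement `pkg_member` (stub `stub_package`, line
# `one-transparent-pane`, item stmt-Langlands-10902, crux
# `Summit.Langlands.Langlands.Theses.QuadraticWindow.HostInducedRep`)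

LOG (wave-3 worker `stub_memberPaneArch`, 2026-08-16): PROVED; the registered signature follows
`theorem stub_memberPaneArch :` verbatim (last declaration); helper file
`…MemberPaneArchGLOne.lean` (anchor `memberPaneArchGLOne_anchor`: `GL₁` base change is
`θ ↦ θ ∘ N_{L/K}` as a weak lift, so the exponent of `θ ∘ N_{L/K}` at an embedding `σ` of `L` is the
exponent of `θ` at `σ|_K` by the PROVED rank-one archimedean strong lifting; and the exponents of
`θ = ψu νk` at every embedding of `K`); two named facts in front (`harch` = Arthur–Clozel strong
lifting at the archimedean places, `hinf` = existence of infinity types), both existing Literature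
`def`s.  No idelic norm is computed at the infinite places: the archimedean behaviour of
`θ ∘ N_{L/K}` is read off the a.e. Satake relation `t_w = θ(ϖ_v)^{f}` (`baseChange_localUnits`) and
`hasArchParameter_of_isWeakBaseChangeLiftAE_glOne` (Literature, proved).

Statement (`PaneArchOut` of `…PaneDefs.lean`).  From the defining relations `MemberRel` (`P₀` a
weak base change of `π ⊗ ω` to `L`, `P = P₀ ⊗ ((ψu νk) ∘ N_{L/K} ∘ det)`, `ψu|_{𝔸_{F₀}} = χ₀ =
(χe ω₀)⁻¹ μ` of finite order, `νk = ‖·‖^{k/2}`) and the pane tower (`[L:F] = 2`): an archimedean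
parameter `χ` of `P` with, at EVERY embedding `σ` of `L`, `χ σ` multiplicity free of cardinality
`n` inside the coset `(n-1)/2 + (m+k)/2 + ℤ` for an integer `m` with `(-1)^m = χ₀,v(-1)`, `v` the
place of `F₀` below `σ`.

Proof.  `π` is regular algebraic (`Hyps`) with infinity type `T_π` (`C`-algebraic, regular);
`π ⊗ ω` has the same (`HasArchParameter.twist`, `ω` of finite order); `P₀` has `T_π^{L/F}`
(`harch.hasInfinityType_baseChange`; `L/F` quadratic, hence Galois and cyclic of prime degree);
the `GL₁` datum of `θ ∘ N_{L/K}` (`θ = ψu νk`) has parameter `σ ↦ {p(σ|_K)}` with `p` the parameter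
of the datum of `θ` (helper file), so `P` has `z`-exponents `{a_i(σ|_F) + p(σ|_K)}` at `σ`
(`exists_hasInfinityType_twist_glOne`): `n` of them, pairwise distinct (`T_π` regular), each in
`(n-1)/2 + ℤ + p(σ|_K)` (`T_π` `C`-algebraic); and `p(σ|_K) = (k + m)/2` with
`(-1)^m = χ₀,v(-1)` (`archParam_embedding_of_restrict`: the restriction identity at the unique
complex place of `K` over the real `v`, `F₀` totally real, `K` totally complex), where the place of
`F₀` below `σ` is the place below `σ|_K` (`IsScalarTower F₀ K L`).
-/

open scoped BigOperators Polynomial Classical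
open Filter Set Polynomial IsDedekindDomain NumberField NumberField.InfinitePlace
open Literature.NumberTheory.Automorphic Literature.NumberTheory.GaloisRepresentations
open Summit.Langlands.Langlands.Theorems.HostInducedRep.GrsExplicitDescent

-- `Summit.Langlands.Langlands.…` (summit = sub-problem name, D-0017 layout) trips `dupNamespace`.
set_option linter.dupNamespace false

noncomputable section

namespace Summit.Langlands.Langlands.Theorems.HostInducedRep.OneTransparentPane

section Main

/-- **Sub-stub PANE-ARCH (`stub_memberPaneArch`; facts `harch`, `hinf`).**  From `MemberRel` and
the pane tower: an archimedean parameter `χ` of `P = BC_{L/F}(π ⊗ ω) ⊗ (ψ₀ ∘ N_{L/K})` with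
`PaneArchOut` — at every embedding `σ` of `L`, `χ σ = {p_i + a}` with the `n` distinct `p_i` of the
regular `C`-algebraic `π` at `σ|_F` (`hasInfinityType_baseChange` along `L/F`) and `a` the exponent
of `ψ₀ ∘ N_{L/K}` at `σ` (`hasArchParameter_twist_glOne`), `a ≡ (m + k)/2 (mod ℤ)` with
`(-1)^m = χ₀((-1)_v)` at the place `v` of `F₀` below `σ`.  Proof: `π` has a regular `C`-algebraic
infinity type `T_π` (`Hyps`), so does `π ⊗ ω` (`ω` of finite order, `HasArchParameter.twist`);
`P₀ = BC_{L/F}(π ⊗ ω)` has `T_π^{L/F}` (`harch`, `L/F` quadratic hence cyclic of prime degree);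
the `GL₁` datum of `θ ∘ N_{L/K}`, `θ = ψu νk`, has the parameter `σ ↦ {p(σ|_K)}` of the datum of
`θ` restricted (rank-one base change, proved), so `P = P₀ ⊗ (θ∘N∘det)` has `z`-exponents
`{a_i(σ|_F) + p(σ|_K)}` — `n` of them, distinct, in `(n-1)/2 + p(σ|_K) + ℤ`; and
`p(σ|_K) = (k + m)/2` with `(-1)^m = χ₀,v(-1)` by the restriction identity `ψu|_{𝔸_{F₀}} = χ₀`
(finite order) at the unique place of `K` over the real place `v` (`archParam_embedding_of_restrict`).
[cite: Clozel1990, §3.3] -/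
theorem stub_memberPaneArch : ArthurClozel1989_strongLifting_archimedean → (∀ (N : ℕ) (K : Type) [Field K] [NumberField K] (hK : isCompact_glFiniteIntegralLevel N K) (P : AutomorphicRepData (AutomorphyDatum.gl N K hK)), P.exists_hasInfinityType) → ∀ (F₀ F : Type) [Field F₀] [NumberField F₀] [Field F] [NumberField F] [Algebra F₀ F] (τ : F ≃ₐ[F₀] F) (n : ℕ) (hcpt : isCompact_glFiniteIntegralLevel n F) (π : CuspidalAutomorphicRepData n F hcpt) (e : FramedGaloisRep F₀ ℂ 1) (k : ℤ) (ℓ : ℕ) [Fact ℓ.Prime] (eψ : FramedGaloisRep F ℂ 1), Hyps τ n π e k ℓ eψ → ∀ (K : Type) [Field K] [NumberField K] [Algebra F₀ K] [IsCMField K] (cK : K ≃ₐ[F₀] K), Module.finrank F₀ K = 2 → cK ≠ 1 → ∀ (L F' : Type) [Field L] [NumberField L] [Field F'] [NumberField F'] [Algebra F₀ L] [Algebra F L] [Algebra K L] [Algebra F' L] [IsScalarTower F₀ F L] [IsScalarTower F₀ K L] [IsGalois K L] (s : L ≃ₐ[F'] L), IsPaneTower τ cK L F' s → ∀ (μ χe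 : HeckeCharacter F₀) (ω : HeckeCharacter F) (hfin : ω.IsFiniteOrder) (ω₀ : HeckeCharacter F₀) (ψu νk ν : HeckeCharacter K) (Pind : CuspidalAutomorphicRepData (2 * n) F₀ (isCompact_glFiniteIntegralLevel_holds (2 * n) F₀)) (PiK τ' : CuspidalAutomorphicRepData (2 * n) K (isCompact_glFiniteIntegralLevel_holds (2 * n) K)) (P₀ P : CuspidalAutomorphicRepData n L (isCompact_glFiniteIntegralLevel_holds n L)), MemberRel π e eψ k μ χe ω hfin ω₀ ψu νk ν Pind PiK τ' P₀ P → ∃ χ : (L →+* ℂ) → Multiset ℂ, PaneArchOut n k ((χe * ω₀)⁻¹ * μ) P.1 χ := by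
  intro harch hinf F₀ F _ _ _ _ _ τ n hcpt π e k ℓ _ eψ hH K _ _ _ _ cK h2K hcK L F' _ _ _ _ _ _ _ _ _ _ _
    s hT μ χe ω hfin ω₀ ψu νk ν Pind PiK τ' P₀ P hrel
  obtain ⟨hTR, -, -, hreg, -⟩ := hH
  obtain ⟨hFL, -⟩ := hT
  obtain ⟨-, -, -, -, hχ₀fin, -, hres, hνk, -, -, -, -, -, hBCL, hPW, hPW'⟩ := hrel
  -- `L/F` is quadratic: Galois, cyclic, of prime degree
  haveI : Algebra.IsQuadraticExtension F L := ⟨hFL⟩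
  haveI : Module.Finite F L := Module.Finite.of_restrictScalars_finite ℚ F L
  haveI : Algebra.IsSeparable F L := Algebra.IsSeparable.of_integral F L
  haveI : IsGalois F L := Algebra.IsQuadraticExtension.isGalois F L
  have hprime : (Module.finrank F L).Prime := by
    rw [hFL]
    exact Nat.prime_two
  -- Step 1: the infinity types of `π ⊗ ω` and of `P₀ = BC_{L/F}(π ⊗ ω)`
  obtain ⟨Tπ, hTπ, hTC, hTreg⟩ := hreg
  have hTπ' : (π.twist ω hfin).1.HasInfinityType Tπ :=
    ⟨hTπ.1, AutomorphicRepData.HasArchParameter.twist π.1 ω hfin hTπ.2⟩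
  have hTP₀ : P₀.1.HasInfinityType (Tπ.baseChange L) :=
    harch.hasInfinityType_baseChange (Algebra.IsQuadraticExtension.isCyclic F L) hprime hBCL hTπ'
  -- Step 2: the `GL₁` data of `θ = ψu νk` and of `θ ∘ N_{L/K}`; the infinity type of `P`
  obtain ⟨χ₁, χ₁L, p, hθ, hp, hpint, hθL, hpL, hpLint⟩ :=
    exists_glOne_archParam_compRelNorm (L := L) (hinf 1 K _) (ψu * νk)
  obtain ⟨T, hT, hTa, -⟩ :=
    exists_hasInfinityType_twist_glOne χ₁L hθL hpL hpLint hPW hPW' hTP₀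
  -- Step 3: the exponents of `θ` at the embeddings of `K`
  have hm : ∀ σ : K →+* ℂ, ∃ m : ℤ, p σ = ((k : ℂ) + m) / 2 ∧
      ((((χe * ω₀)⁻¹ * μ).archComponent ((InfinitePlace.mk σ).comap (algebraMap F₀ K)) (-1) :
        ℂˣ) : ℂ) = (-1 : ℂ) ^ m :=
    archParam_embedding_of_restrict hTR h2K χ₁ hθ hp hpint hres hχ₀fin hνk
  refine ⟨fun σ ↦ (T σ).map ArchWeight.a, hT.2, fun σ ↦ ?_⟩
  obtain ⟨m, hpm, hχm⟩ := hm (σ.comp (algebraMap K L))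
  have hTσ : (T σ).map ArchWeight.a =
      ((Tπ (σ.comp (algebraMap F L))).map ArchWeight.a).map (· + p (σ.comp (algebraMap K L))) := by
    rw [hTa σ, InfinityType.baseChange_apply]
  have hplace : InfinitePlace.mk (σ.comp (algebraMap F₀ L)) =
      (InfinitePlace.mk (σ.comp (algebraMap K L))).comap (algebraMap F₀ K) := by
    rw [comap_mk, RingHom.comp_assoc, ← IsScalarTower.algebraMap_eq F₀ K L]
  dsimp only
  rw [hTσ, hplace]
  refine ⟨(hTreg _).map (add_left_injective _), ?_, m, hχm, fun a ha ↦ ?_⟩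
  · rw [Multiset.card_map, Multiset.card_map, hTπ.1.1]
  · obtain ⟨a₀, ha₀, rfl⟩ := Multiset.mem_map.mp ha
    obtain ⟨w₀, hw₀, rfl⟩ := Multiset.mem_map.mp ha₀
    obtain ⟨i, -, hi, -⟩ := hTC _ w₀ hw₀
    exact ⟨i, by simp only [hi, hpm]; ring⟩

end Main

end Summit.Langlands.Langlands.Theorems.HostInducedRep.OneTransparentPane

end
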